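import Summits.QuantumFields.YangMills.Theorems.AlphaInputsT3ACv3LinearLiftGauge
import Summits.QuantumFields.YangMills.Theorems.AlphaInputsT3ACv3AbelianLocal
import Literature.MathematicalPhysics.QuantumFieldTheory.Balaban1983to89.B5Eq117TorusCarriers
import HarnessLib

/-!
# `AlphaInputsT3ACv3LinearLiftSegFlat` — (LL) STEP L2b-i: THE FLAT FORMULA FOR THE ITERATED TRANSPORTED-SEGMENT MEAN — `M^k a(z, μ)` is the mean over the `L^{kd}` finest
# sites `x` of the `k`-block of `z` of the straight run sums `Σ_{m<L^k} a(x + m e_μ)` — cell `ym3-torus`, width seat `ym-ust-19936-w2` (g0)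

WHY.  The exactness leg of the linear lift (plan L1–L5, HOME `ym3-torus/ym-ust-19936-w2/LL-PLAN-w2-g0.md`) is `segIter k (S¹A) = A` (file L2b-iii); it is proved from the
FLAT (non-recursive) form of `segIter k` (`AlphaInputsT3ACv3LinearLiftGauge.segIter`, the `k`-fold iterate of the one-step segment mean `segOp`): nested blocks compose
(`B5Eq118OneStroke.iterBlock`, `B5Eq117TorusCarriers.blockSiteK`) and straight runs concatenate.
* §1 `shiftN_shiftN_add`, `runSum_add`, `runSum_mul` (a run of `c·n` steps is `c` consecutive runs of `n` steps).
* §2 `segOp_apply` — the one-step segment mean as `(L^d)⁻¹ Σ_{x ∈ B(y)} runSum a x μ L` (sum over the index set `Idx` collapsed; `offPt = blockSite`).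
* §3 `blockSiteK_shiftN` (the `k`-block of `y + m′e_μ` is the `k`-block of `y` translated by `m′L^k` fine steps), `sum_iterBlock_shiftN`, `sum_iterBlock_succ` (nested blocks),
  ★ `segIter_apply : segIter k a ⟨z, μ⟩ = ((L^k)^d)⁻¹ · Σ_{x ∈ B^k(z)} runSum a x μ (L^k)`.
HONEST FRAMING.  Lattice bookkeeping; nothing of [Balaban1987RG1]∕[Balaban1984PropagatorsI] asserted beyond their definitions; count-neutral helper toward the (FL) row of 2′∕2′χ
(`--supports stmt-QuantumFields-19936`); registry untouched.  YM₃ on the torus is a RUNG of the programme, not the Clay problem; no claim about d = 4, infinite volume or a mass gap.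

References: T. Bałaban, Commun. Math. Phys. 109 (1987) 249–301 [Balaban1987RG1] ((0.3)–(0.4) pp.252–253, (0.11) p.253); Commun. Math. Phys. 95 (1984) 17–40
[Balaban1984PropagatorsI] ((1.18) p.20: the blocks `B^k(y)` and straight contours).
-/

set_option autoImplicit false

noncomputable section

namespace Summit.QuantumFields.YangMills.Theorems.LinearLiftGauge

open Finset
open Literature.MathematicalPhysics.QuantumFieldTheory.Balaban1983to89
open Literature.MathematicalPhysics.QuantumFieldTheory.Balaban1983to89.T4Continuum
open Literature.MathematicalPhysics.QuantumFieldTheory.Balaban1983to89.BlockAveraging (off Idx)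
open Literature.MathematicalPhysics.QuantumFieldTheory.Balaban1983to89.BlockAveragingEMLProp2 (shiftN_apply)
open Literature.MathematicalPhysics.QuantumFieldTheory.Balaban1983to89.B10Eq47AxialChi (shiftN shiftN_zero shiftN_succ)
open Literature.MathematicalPhysics.QuantumFieldTheory.Balaban1983to89.B5Eq118OneStroke (iterBlock iterBlockOf mem_iterBlock mem_iterBlock_iff iterBlock_zero iterBlockOf_succ)
open Literature.MathematicalPhysics.QuantumFieldTheory.Balaban1983to89.B5Eq117TorusCarriers (blockSiteK val_blockSiteK sum_iterBlock_eq sitesPerDir_zero_eq)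
open Summit.QuantumFields.YangMills.Theorems.AbelianEML

variable {P : Params} {j : ℕ}

/-! ## §1 Runs concatenate -/

/-- Iterated shifts add up: `(x + a e_μ) + b e_μ = x + (a+b) e_μ`. [folklore] -/
theorem shiftN_shiftN_add (x : Site P j) (μ : Fin P.d) (a : ℕ) : ∀ b : ℕ, shiftN (shiftN x μ a) μ b = shiftN x μ (a + b)
  | 0 => rfl
  | b + 1 => by rw [← Nat.add_assoc, shiftN_succ, shiftN_succ, shiftN_shiftN_add x μ a b]

/-- **Run sums concatenate**: `runSum a x μ (p + q) = runSum a x μ p + runSum a (x + p e_μ) μ q`. [cite: Balaban1984PropagatorsI, (1.7) p.18 (bookkeeping)] -/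
theorem runSum_add (a : PBond P j → ℝ) (x : Site P j) (μ : Fin P.d) (p q : ℕ) :
    runSum a x μ (p + q) = runSum a x μ p + runSum a (shiftN x μ p) μ q := by
  unfold runSum
  rw [sum_range_add]
  congr 1
  refine sum_congr rfl fun i _ => ?_
  rw [shiftN_shiftN_add]

/-- A run of `c·n` steps is `c` consecutive runs of `n` steps. [cite: Balaban1984PropagatorsI, (1.7) p.18 (bookkeeping)] -/
theorem runSum_mul (a : PBond P j → ℝ) (x : Site P j) (μ : Fin P.d) (n : ℕ) : ∀ c : ℕ,
    runSum a x μ (c * n) = ∑ i ∈ range c, runSum a (shiftN x μ (i * n)) μ n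
  | 0 => by simp [runSum]
  | c + 1 => by rw [Nat.succ_mul, runSum_add, runSum_mul a x μ n c, sum_range_succ]

/-! ## §2 The one-step segment mean, flat -/

/-- A sum over the index set `Idx = offsets × orderings²` of a function of the offset alone. [cite: Balaban1987RG1, (0.4) p.253 (bookkeeping)] -/
theorem sum_Idx_fst (f : (Fin P.d → Fin P.L) → ℝ) :
    ∑ i : Idx P, f i.1 = (Fintype.card (Equiv.Perm (Fin P.d) × Equiv.Perm (Fin P.d)) : ℝ) * ∑ r : Fin P.d → Fin P.L, f r := by
  rw [Fintype.sum_prod_type, mul_sum]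
  refine sum_congr rfl fun r _ => ?_
  simp only [sum_const, card_univ]
  rw [nsmul_eq_mul]

/-- `|Idx| = L^d · |orderings²|`. [folklore] -/
theorem card_Idx : (Fintype.card (Idx P) : ℝ) = (P.L : ℝ) ^ P.d * Fintype.card (Equiv.Perm (Fin P.d) × Equiv.Perm (Fin P.d)) := by
  simp only [Idx, Fintype.card_prod, Fintype.card_fun, Fintype.card_fin]
  push_cast; ring

/-- A sum over the offsets `r` of a function of the block site `blockSite y r` is the sum over the block `B(y)`. [cite: Balaban1987RG1, (0.3) p.252] -/
theorem sum_blockSite_eq (hj : j + 1 ≤ P.m + P.K) (y : Site P (j + 1)) (g : Site P j → ℝ) :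
    ∑ r : Fin P.d → Fin P.L, g (Site.blockSite y r) = ∑ x ∈ block y, g x := by
  have hmem : ∀ x, x ∈ block y ↔ blockOf x = y := fun x => by simp [block]
  rw [sum_subtype (block y) hmem (fun x => g x)]
  exact Fintype.sum_equiv (Site.blockEquiv hj y).symm (fun r => g (Site.blockSite y r)) (fun x => g x.1) fun r => rfl

/-- **THE ONE-STEP TRANSPORTED-SEGMENT MEAN, FLAT**: `segOp a c = (L^d)⁻¹ Σ_{x ∈ B(c₋)} runSum a x (dir c) L` — the index set collapses to the offsets, the offset points are the
block sites. [cite: Balaban1987RG1, (0.4) p.253] -/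
theorem segOp_apply (hj : j + 1 ≤ P.m + P.K) (a : PBond P j → ℝ) (c : PBond P (j + 1)) :
    segOp a c = ((P.L : ℝ) ^ P.d)⁻¹ * ∑ x ∈ block c.src, runSum a x c.dir P.L := by
  unfold segOp segMean segSum
  have e : ∀ i : Idx P, wsum a (offPt c.src (off i.1)) (List.replicate P.L (c.dir, true)) = runSum a (Site.blockSite c.src i.1) c.dir P.L := by
    intro i; rw [wsum_replicate_true, offPt_off_eq_blockSite]
  simp_rw [e]
  have hb := sum_blockSite_eq hj c.src (fun s => runSum a s c.dir P.L)
  rw [sum_Idx_fst (fun r => runSum a (Site.blockSite c.src r) c.dir P.L), hb, card_Idx, ← mul_assoc]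
  congr 1
  have hL : (0 : ℝ) < (P.L : ℝ) ^ P.d := pow_pos (Nat.cast_pos.mpr P.L_pos) _
  have hc : (0 : ℝ) < Fintype.card (Equiv.Perm (Fin P.d) × Equiv.Perm (Fin P.d)) := Nat.cast_pos.mpr Fintype.card_pos
  field_simp

/-! ## §3 Nested blocks and the `k`-fold flat formula -/

/-- Cast of a residue times the cell side: `((a mod N_k)·n : ℤ/N₀) = (a·n : ℤ/N₀)` for `N₀ = n·N_k`. [folklore] -/
theorem natCast_mod_mul {N₀ Nk n : ℕ} (hN : N₀ = n * Nk) (a : ℕ) : (((a % Nk) * n : ℕ) : ZMod N₀) = ((a * n : ℕ) : ZMod N₀) := by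
  rw [ZMod.natCast_eq_natCast_iff', hN, mul_comm n Nk, Nat.mul_mod_mul_right, Nat.mul_mod_mul_right, Nat.mod_mod]

/-- **THE `k`-BLOCK OF `y + m′e_μ` IS THE `k`-BLOCK OF `y` TRANSLATED BY `m′L^k` FINE STEPS** (offset by offset). [cite: Balaban1984PropagatorsI, (1.18) p.20] -/
theorem blockSiteK_shiftN {k : ℕ} (hk : k ≤ P.m + P.K) (y : Site P k) (μ : Fin P.d) (m' : ℕ) (jj : Fin P.d → Fin (P.L ^ k)) :
    blockSiteK k (shiftN y μ m') jj = shiftN (blockSiteK k y jj) μ (m' * P.L ^ k) := by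
  funext ν
  rw [shiftN_apply]
  unfold blockSiteK
  rw [shiftN_apply]
  by_cases hν : ν = μ
  · subst hν
    simp only [if_true]
    rw [ZMod.val_add, ZMod.val_natCast, Nat.add_mod_mod]
    push_cast
    have key := natCast_mod_mul (sitesPerDir_zero_eq hk) (n := P.L ^ k) (Nk := P.sitesPerDir k) ((y ν).val + m')
    push_cast at key
    rw [key]; ring
  · simp only [if_neg hν, add_zero]

/-- Hence a sum over the `k`-block of `y + m′e_μ` is the sum over the `k`-block of `y` of the translated summand. [cite: Balaban1984PropagatorsI, (1.18) p.20] -/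
theorem sum_iterBlock_shiftN {k : ℕ} (hk : k ≤ P.m + P.K) (y : Site P k) (μ : Fin P.d) (m' : ℕ) (g : Site P 0 → ℝ) :
    ∑ x ∈ iterBlock k (shiftN y μ m'), g x = ∑ x ∈ iterBlock k y, g (shiftN x μ (m' * P.L ^ k)) := by
  rw [sum_iterBlock_eq hk, sum_iterBlock_eq hk]
  refine sum_congr rfl fun jj _ => ?_
  rw [blockSiteK_shiftN hk]

/-- **NESTED BLOCKS**: a sum over `B^{k+1}(z)` is the sum over the `L^d` blocks `B^k(y)`, `y ∈ B(z)`. [cite: Balaban1984PropagatorsI, (1.18) p.20] -/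
theorem sum_iterBlock_succ {k : ℕ} (z : Site P (k + 1)) (g : Site P 0 → ℝ) :
    ∑ x ∈ iterBlock (k + 1) z, g x = ∑ y ∈ block z, ∑ x ∈ iterBlock k y, g x := by
  have hmaps : ∀ x ∈ iterBlock (k + 1) z, iterBlockOf k x ∈ block z := by
    intro x hx
    rw [mem_iterBlock, iterBlockOf_succ] at hx
    simp [block, hx]
  rw [← sum_fiberwise_of_maps_to hmaps]
  refine sum_congr rfl fun y hy => ?_
  have hy' : blockOf y = z := by simpa [block] using hy
  congr 1
  ext x
  simp only [mem_filter, mem_iterBlock, iterBlockOf_succ]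
  constructor
  · exact fun h => h.2
  · intro h; exact ⟨by rw [h, hy'], h⟩

/-- **★ THE `k`-FOLD TRANSPORTED-SEGMENT MEAN, FLAT**: `segIter k a ⟨z, μ⟩ = ((L^k)^d)⁻¹ · Σ_{x ∈ B^k(z)} Σ_{m<L^k} a(x + m e_μ, μ)` — the mean over the `L^{kd}` finest sites of the
`k`-block of `z` of the straight run sums of `L^k` steps. [cite: Balaban1987RG1, (0.4)+(0.11) p.253; Balaban1984PropagatorsI, (1.18) p.20] -/
theorem segIter_apply (a : PBond P 0 → ℝ) : ∀ (k : ℕ), k ≤ P.m + P.K → ∀ (z : Site P k) (μ : Fin P.d),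
    segIter k a ⟨z, μ⟩ = (((P.L : ℝ) ^ k) ^ P.d)⁻¹ * ∑ x ∈ iterBlock k z, runSum a x μ (P.L ^ k)
  | 0, _, z, μ => by
    rw [iterBlock_zero, sum_singleton]
    simp [segIter, runSum]
  | k + 1, hk, z, μ => by
    have hk' : k ≤ P.m + P.K := by omega
    have hL : (0 : ℝ) < P.L := Nat.cast_pos.mpr P.L_pos
    show segOp (segIter k a) ⟨z, μ⟩ = _
    rw [segOp_apply hk]
    -- unfold the run of the coarse field and apply the induction hypothesis at each shifted block point
    have e1 : ∀ y ∈ block z, runSum (segIter k a) y μ P.L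
        = (((P.L : ℝ) ^ k) ^ P.d)⁻¹ * ∑ x ∈ iterBlock k y, runSum a x μ (P.L * P.L ^ k) := by
      intro y _
      rw [show runSum (segIter k a) y μ P.L = ∑ s ∈ range P.L, segIter k a ⟨shiftN y μ s, μ⟩ from rfl]
      have e2 : ∀ s ∈ range P.L, segIter k a ⟨shiftN y μ s, μ⟩ = (((P.L : ℝ) ^ k) ^ P.d)⁻¹ * ∑ x ∈ iterBlock k y, runSum a (shiftN x μ (s * P.L ^ k)) μ (P.L ^ k) := by
        intro s _
        rw [segIter_apply a k hk' (shiftN y μ s) μ, sum_iterBlock_shiftN hk']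
      rw [sum_congr rfl e2, ← mul_sum, sum_comm]
      congr 1
      refine sum_congr rfl fun x _ => ?_
      rw [runSum_mul]
    rw [sum_congr rfl e1, ← mul_sum, ← mul_assoc, ← sum_iterBlock_succ, pow_succ, mul_comm ((P.L : ℝ) ^ k) (P.L : ℝ)]
    congr 1
    · rw [mul_pow, mul_inv]
    · rw [pow_succ, Nat.mul_comm]

end Summit.QuantumFields.YangMills.Theorems.LinearLiftGauge

end
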